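import Literature.Probability.Percolation.HalfSpaceFloorDilution
import Literature.Probability.Percolation.UniversalTightness

/-! Scratch (lead c4): the fully-qualified, gate-printable signature of B♯ (candidate restatement of crux B) and its
definitional agreement with the registered stub text of stmt-14713 `stub_noFatHalfBoxOrigin`. -/

open MeasureTheory

/-- B♯ with Literature constants fully qualified. -/
def BSharpRoute : Prop :=
  ∃ C : ℝ, 0 < C ∧ ∀ n : ℕ, 1 ≤ n → (Literature.Probability.Percolation.floorDilutedPercolation 3 (Literature.Probability.Percolation.criticalProbI 3) 1).real {ω | C * (n : ℝ) ^ ((11 : ℝ) / 4) ≤ (Literature.Probability.Percolation.clusterMaxIn ((Literature.Probability.LatticeModels.box 3 n).filter fun z : Literature.Probability.LatticeModels.Site 3 => 0 ≤ z 0) ω : ℝ)} ≤ Real.exp (-1)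

open Literature.Probability.Percolation Literature.Probability.LatticeModels in
example : BSharpRoute ↔ (∃ C : ℝ, 0 < C ∧ ∀ n : ℕ, 1 ≤ n → (floorDilutedPercolation 3 (criticalProbI 3) 1).real {ω | C * (n : ℝ) ^ ((11 : ℝ) / 4) ≤ (clusterMaxIn ((box 3 n).filter fun z : Site 3 => 0 ≤ z 0) ω : ℝ)} ≤ Real.exp (-1)) :=
  Iff.rfl
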